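/-
Origin: expansion seat `planner-pub-hodgecm-mc-theta-3-g3-0`, handover #2 2026-08-19T00:28Z md5 514e5f1429ce1fccf96b9be7a7a6c733 (NEW additive leaf, 341 l.; ns HodgeCM.Model.ThetaSpace; imports HodgeCM.Model.SupplyClassLevel (#1) only; transport of class-map data / theta classes between restriction situations (thetaClasses_map_mem_of_restrict_eq = PKG-local twin of period-1-g3 (H') T1, transportDatum, thetaClasses_transport_subset, coe_restrictHom_id, isLevelCorrecte (`HOME/mc/pub-hodgecm-mc-theta-3-g3/lean/stage/HodgeCM/Model/ThetaSpace.lean`, md5 514e5f14, 341 lines);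
landed by the gen-9 packager (p-g9) in gate run 33 as `HodgeCM/Model/ThetaSpace.lean` (verbatim).
-/
/-
Copyright (c) 2026. Released under Apache 2.0 license as described in the file LICENSE.
Cell pub-hodgecm, MODEL layer (construction prover mc-theta-3, gen 3), nodes W6b-2 / J-W7a of `MODEL-DAG.md`:
the classical theta space of a level and the junction of the adelic supply data with it.
-/
import Summits.HodgeConjecture.HodgeCM.Model.SupplyClassLevel

/-!
# The theta space of a level, and class supply data cut from a `K`-type situation

The model's theta one-form set at level `Γ` is `thetaOf U I V c k Γ = thetaClasses (I V c).ιinf ((I V c).D Γ)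
((I V c).Θ k Γ)` (`Model/ThetaSideInstance`, (v21)) for ONE restriction situation `(GU, Kc, κ, τ, ιinf, η₁)`
per context, whereas the adelic theta forms that supply non-zero classes live, for the test function `φ_N`,
in a `K`-type situation `Kc(N) = K_∞ × K_f(N)` that SHRINKS with `N` (findings F1/F2 of the gen-3 seat).
The two are reconciled on the CLASSICAL side, where every adelic situation restricts to the same space of
classical weight forms `weightForms Δ κ₁ τ₁` on the archimedean group `G₁`:

* `KTypeSituation P ιinf Δ κ₁ τ₁` — an adelic `K`-type situation over the pair data `P` restricting to the
  archimedean component `(G₁, Δ, K₁, κ₁, τ₁)`: `Kc, κ, E, σ, τ, ι, hι, η₁`, the tree hypotheses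
  `IsLevelCorrected P.ΓU κ τ ιinf Δ` / `IsWeightMatched κ τ ιinf κ₁ τ₁ η₁`, and a set `𝓙` of theta-equivariant
  test families; `S.thetaForms 𝓕` = the tree's space of adelic theta forms of the situation, `S.forms 𝓕` =
  its image under the archimedean restriction `restrictHom ιinf S.hΔ S.hη`;
* **`thetaSpaceOf P ιinf Δ κ₁ τ₁ 𝓕 := ⨆ S, S.forms 𝓕`** — the classical theta space of the level: the span of
  the restrictions to `Δ \ G₁` of ALL adelic theta forms of the pair with weight functions in `𝓕`, every
  `K`-type allowed (the value the `I`-producer gives to `ThetaClassInput.Θ k Γ` in the classical instance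
  `GU := G₁`, `ιinf := id`); `exists_mem_thetaSpaceOf_coe_eq_of_le` — its level monotonicity (`KTypeSituation.ofLE`);
* `transportDatum` — a class-map datum only sees the archimedean component `(Δ, κ₁, τ₁)` and the coefficient
  space, so it transports between restriction situations sharing them; KERNEL
  `thetaClasses_map_mem_of_restrict_eq` — theta classes are carried along a map of coefficient spaces as
  soon as the pullbacks, the holomorphic subspaces and the RESTRICTED forms match (the tree's / period lane's
  level-change lemma with the two situations fully independent, keyed on equality of restrictions);
* KERNEL **`thetaClasses_situation_subset_thetaSpace`**: the theta classes of ONE adelic situation (through the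
  transported datum) lie in the theta classes of the classical theta space (through the classical datum over
  `MonoidHom.id G₁`) — the content of the field `ClassSupplyDataAt.theta_sub`;
* `KTypeSituation.classSupplyDataAt` — level-indexed class supply data at `φ_N` CUT FROM a `K`-type situation, a
  level `Γ₀`, a classical class-map datum `D₀` of `Γ₀ \ 𝔹²` into the model universe, the identification
  `thetaClasses id D₀ (thetaSpaceOf …) ⊆ T.Theta V c k Γ₀` (an EQUALITY by `rfl` for the model's `T`), and
  the three analytic properties `fam` / `char_mem` / `hol`.

Nothing is cited and nothing is minted: definitions and kernel lemmas over the tree's `weightForms`,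
`restrictHom`, `ClassMapDatum`, `thetaClasses`, `ThetaKernelDatum.thetaForms`.
-/

set_option autoImplicit false

noncomputable section

open MeasureTheory NumberField NumberField.mixedEmbedding IsDedekindDomain
open Literature.NumberTheory.Automorphic Literature.NumberTheory.Weil1964
open Literature.NumberTheory.Automorphic.WeightForms (ClassMapDatum thetaClasses restrictHom IsLevelCorrected
  IsWeightMatched)
open HodgeCM.PerL34.Seesaw HodgeCM.PerL34.RationalCoset HodgeCM.PerL34.SupplyAdelic
open HodgeCM.Model.SupplyInstance HodgeCM.Model.SupplyResidual
open HodgeCM.Model.SupplyResidual.WeilPairData (charInv)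
open scoped Classical

namespace HodgeCM
namespace Model
namespace ThetaSpace

/-! ### § 1. Transport of class-map data and of theta classes between restriction situations -/

section Transport

variable {GU : Type*} [Group GU] {GU' : Type*} [Group GU'] {G₁ : Type*} [Group G₁]
variable {Kc : Type*} [Group Kc] {Kc' : Type*} [Group Kc'] {K₁ : Type*} [Group K₁]
variable {W : Type*} [AddCommGroup W] [Module ℂ W]
variable {ΓU : Subgroup GU} {ΓU' : Subgroup GU'} {κ : Kc →* GU} {κ' : Kc' →* GU'}
  {τ : Representation ℂ Kc W} {τ' : Representation ℂ Kc' W}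
variable (ι : G₁ →* GU) (ι' : G₁ →* GU') {Δ Δ' : Subgroup G₁} {κ₁ : K₁ →* G₁} {τ₁ : Representation ℂ K₁ W}
variable {hΔ : IsLevelCorrected ΓU κ τ ι Δ} {hΔ' : IsLevelCorrected ΓU' κ' τ' ι' Δ'}
  {η₁ : K₁ →* Kc} {η₁' : K₁ →* Kc'}
  {hη : IsWeightMatched κ τ ι κ₁ τ₁ η₁} {hη' : IsWeightMatched κ' τ' ι' κ₁ τ₁ η₁'}
variable {H : Type*} [AddCommGroup H] [Module ℂ H] {H' : Type*} [AddCommGroup H'] [Module ℂ H']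

/-- **Theta classes along a map of coefficient spaces, two restriction situations.**  `D`, `D'` are class-map
data over two restriction situations with the same archimedean component group `G₁`, compact `K₁`, `κ₁`,
weight `τ₁` (levels `Δ`, `Δ'`; ambient groups, `K`-types, levels and weights otherwise unrelated) and
`f : H → H'`.  If `f` maps `(1,0)`-classes to `(1,0)`-classes, the pullbacks agree along `f` as functions on
`G₁`, holomorphy after restriction depends only on the underlying function, and every form of `Θ` RESTRICTS to
the restriction of a form of `Θ'`, then `f` carries theta classes of `(D, Θ)` to theta classes of `(D', Θ')`. -/
theorem thetaClasses_map_mem_of_restrict_eq (D : ClassMapDatum ι hΔ hη H) (D' : ClassMapDatum ι' hΔ' hη' H')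
    (f : H → H') (hf10 : ∀ c ∈ D.H10, f c ∈ D'.H10)
    (hpull : ∀ c : D.H10, ((D'.pull ⟨f c, hf10 c c.2⟩ : weightForms Δ' κ₁ τ₁) : G₁ → W) =
      ((D.pull c : weightForms Δ κ₁ τ₁) : G₁ → W))
    (hHol : ∀ g ∈ D.Hol, ∀ g' : weightForms Δ' κ₁ τ₁, (g' : G₁ → W) = (g : G₁ → W) → g' ∈ D'.Hol)
    {Θ : Submodule ℂ (weightForms ΓU κ τ)} {Θ' : Submodule ℂ (weightForms ΓU' κ' τ')}
    (hΘ : ∀ F ∈ Θ, ∃ F' ∈ Θ', (restrictHom ι' hΔ' hη' F' : G₁ → W) = (restrictHom ι hΔ hη F : G₁ → W))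
    {h : H} (hh : h ∈ thetaClasses ι D Θ) : f h ∈ thetaClasses ι' D' Θ' := by
  obtain ⟨c, rfl, F, hF, hFhol, hc⟩ := hh
  obtain ⟨F', hF', hres⟩ := hΘ F hF
  refine ⟨⟨f c, hf10 c c.2⟩, rfl, F', hF', hHol _ hFhol _ hres, ?_⟩
  apply Subtype.ext
  rw [hpull c, hc, hres]

/-- **Transport of a class-map datum** to another restriction situation with the SAME archimedean component
`(G₁, Δ, K₁, κ₁, τ₁)` and coefficient space: the fields `H10`, `pull`, `Hol`, `descends` only see those. -/
def transportDatum (D : ClassMapDatum ι hΔ hη H) (hΔ₂ : IsLevelCorrected ΓU' κ' τ' ι' Δ)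
    (hη₂ : IsWeightMatched κ' τ' ι' κ₁ τ₁ η₁') : ClassMapDatum ι' hΔ₂ hη₂ H where
  H10 := D.H10
  pull := D.pull
  Hol := D.Hol
  descends := D.descends

variable {hΔ₂ : IsLevelCorrected ΓU' κ' τ' ι' Δ} {hη₂ : IsWeightMatched κ' τ' ι' κ₁ τ₁ η₁'}

/-- (Ported verbatim from the HodgeCMPerL package; no docstring in the source.) -/
@[simp] theorem transportDatum_H10 (D : ClassMapDatum ι hΔ hη H) :
    (transportDatum ι ι' D hΔ₂ hη₂).H10 = D.H10 := rfl

/-- (Ported verbatim from the HodgeCMPerL package; no docstring in the source.) -/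
@[simp] theorem transportDatum_pull (D : ClassMapDatum ι hΔ hη H) :
    (transportDatum ι ι' D hΔ₂ hη₂).pull = D.pull := rfl

/-- (Ported verbatim from the HodgeCMPerL package; no docstring in the source.) -/
@[simp] theorem transportDatum_Hol (D : ClassMapDatum ι hΔ hη H) :
    (transportDatum ι ι' D hΔ₂ hη₂).Hol = D.Hol := rfl

/-- **Theta classes through a transported datum lie in the theta classes through the original one** as soon
as every form of the new space restricts to the restriction of a form of the old space. -/
theorem thetaClasses_transport_subset (D : ClassMapDatum ι hΔ hη H)
    {Θ : Submodule ℂ (weightForms ΓU κ τ)} {Θ' : Submodule ℂ (weightForms ΓU' κ' τ')}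
    (hΘ : ∀ F' ∈ Θ', ∃ F ∈ Θ, (restrictHom ι hΔ hη F : G₁ → W) = (restrictHom ι' hΔ₂ hη₂ F' : G₁ → W)) :
    thetaClasses ι' (transportDatum ι ι' D hΔ₂ hη₂) Θ' ⊆ thetaClasses ι D Θ := by
  intro h hh
  have := thetaClasses_map_mem_of_restrict_eq ι' ι (transportDatum ι ι' D hΔ₂ hη₂) D id (fun _ hc => hc)
    (fun _ => rfl) (fun g hg g' hgg' => by rwa [show g' = g from Subtype.ext hgg']) hΘ hh
  exact this

/-- The classical situation `ι = id`: restriction does not change the underlying function. -/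
theorem coe_restrictHom_id {ΓU₀ : Subgroup G₁} {η₀ : K₁ →* K₁}
    (hΔ₀ : IsLevelCorrected ΓU₀ κ₁ τ₁ (MonoidHom.id G₁) Δ)
    (hη₀ : IsWeightMatched κ₁ τ₁ (MonoidHom.id G₁) κ₁ τ₁ η₀) (F : weightForms ΓU₀ κ₁ τ₁) :
    (restrictHom (MonoidHom.id G₁) hΔ₀ hη₀ F : G₁ → W) = (F : G₁ → W) := rfl

/-- Level correction in the classical situation (`c := 1`). -/
theorem isLevelCorrected_id (Δ : Subgroup G₁) (κ₁ : K₁ →* G₁) (τ₁ : Representation ℂ K₁ W) :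
    IsLevelCorrected Δ κ₁ τ₁ (MonoidHom.id G₁) Δ :=
  fun δ hδ => ⟨1, map_one _, by simp [hδ], fun x => by simp⟩

/-- Weight matching in the classical situation (`η₁ := id`). -/
theorem isWeightMatched_id (κ₁ : K₁ →* G₁) (τ₁ : Representation ℂ K₁ W) :
    IsWeightMatched κ₁ τ₁ (MonoidHom.id G₁) κ₁ τ₁ (MonoidHom.id K₁) :=
  ⟨fun _ => rfl, fun _ => rfl⟩

end Transport

/-! ### § 2. `K`-type situations over the pair data and the theta space of a level -/

section Situation

variable {K L : Type} [Field K] [NumberField K] [Field L] [NumberField L] [Algebra K L] [FiniteDimensional K L]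
variable {J : Type} [Fintype J] {GU : Type} [Group GU] [TopologicalSpace GU] [IsTopologicalGroup GU]
  [LocallyCompactSpace GU]
variable (P : WeilPairData K L J GU) [CompactSpace (GU ⧸ P.ΓU)]
variable {G₁ K₁ W : Type} [Group G₁] [Group K₁] [AddCommGroup W] [Module ℂ W]
variable (ιinf : G₁ →* GU) (Δ : Subgroup G₁) (κ₁ : K₁ →* G₁) (τ₁ : Representation ℂ K₁ W)

/-- **An adelic `K`-type situation** over the pair data `P` restricting to the archimedean component
`(G₁, Δ, K₁, κ₁, τ₁)` along `ιinf`: the `K`-type bookkeeping of `ClassSupplyDataAt` without the level, the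
class-map datum and the analytic properties. -/
structure KTypeSituation : Type 1 where
  /-- index group of the `K`-types (`K_f × K_∞`) -/
  Kc : Type
  [instKc : Group Kc]
  /-- its map to `G_U(𝔸)` -/
  κ : Kc →* GU
  /-- the `K`-type containing `φ_∞` -/
  E : Type
  [instE : AddCommGroup E]
  [instEm : Module ℂ E]
  /-- the action of `Kc` on it -/
  σ : Representation ℂ Kc E
  /-- the weight as a representation of `Kc` -/
  τ : Representation ℂ Kc W
  /-- the `Kc`-map `W^∨ → E` -/
  ι : Module.Dual ℂ W →ₗ[ℂ] E
  /-- … intertwining `τ^∨` and `σ` -/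
  hι : ∀ (x : Kc) (ℓ : Module.Dual ℂ W), ι (τ.dual x ℓ) = σ x (ι ℓ)
  /-- `K₁ → Kc` over `ιinf` -/
  η₁ : K₁ →* Kc
  /-- level correction (tree `WeightForms.IsLevelCorrected`) -/
  hΔ : IsLevelCorrected P.ΓU κ τ ιinf Δ
  /-- weight matching (tree `WeightForms.IsWeightMatched`) -/
  hη : IsWeightMatched κ τ ιinf κ₁ τ₁ η₁
  /-- the theta-equivariant test families of the situation -/
  𝓙 : Set {j : E →ₗ[ℂ] P.weilDatum.ThetaTop // P.kernelDatum.IsThetaEquivariant κ σ j}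

attribute [instance] KTypeSituation.instKc KTypeSituation.instE KTypeSituation.instEm

variable {P ιinf Δ κ₁ τ₁}
variable [Module.IsReflexive ℂ W]

/-- The adelic theta forms of the situation with weight functions in `𝓕` (tree `ThetaKernelDatum.thetaForms`). -/
def KTypeSituation.thetaForms (S : KTypeSituation P ιinf Δ κ₁ τ₁)
    (𝓕 : Set C(relNormOneIdeles K L ⧸ relNormOneRat K L, ℂ)) : Submodule ℂ (weightForms P.ΓU S.κ S.τ) :=
  P.kernelDatum.thetaForms (probHaarRelNormOneQuot K L) P.kernelDatum_thetaLinear S.κ S.σ S.ι S.hι S.𝓙 𝓕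

/-- Their archimedean restrictions: classical weight forms of level `Δ` and weight `τ₁` on `G₁`. -/
def KTypeSituation.forms (S : KTypeSituation P ιinf Δ κ₁ τ₁)
    (𝓕 : Set C(relNormOneIdeles K L ⧸ relNormOneRat K L, ℂ)) : Submodule ℂ (weightForms Δ κ₁ τ₁) :=
  (S.thetaForms 𝓕).map (restrictHom ιinf S.hΔ S.hη)

/-- (Ported verbatim from the HodgeCMPerL package; no docstring in the source.) -/
theorem KTypeSituation.restrictHom_mem_forms (S : KTypeSituation P ιinf Δ κ₁ τ₁)
    {𝓕 : Set C(relNormOneIdeles K L ⧸ relNormOneRat K L, ℂ)} {F : weightForms P.ΓU S.κ S.τ}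
    (hF : F ∈ S.thetaForms 𝓕) : restrictHom ιinf S.hΔ S.hη F ∈ S.forms 𝓕 :=
  Submodule.mem_map_of_mem hF

variable (P ιinf Δ κ₁ τ₁) in
/-- **The classical theta space of the level**: the span of the archimedean restrictions of all adelic theta
forms of the pair with weight functions in `𝓕`, over all `K`-type situations. -/
def thetaSpaceOf (𝓕 : Set C(relNormOneIdeles K L ⧸ relNormOneRat K L, ℂ)) : Submodule ℂ (weightForms Δ κ₁ τ₁) :=
  ⨆ S : KTypeSituation P ιinf Δ κ₁ τ₁, S.forms 𝓕

/-- (Ported verbatim from the HodgeCMPerL package; no docstring in the source.) -/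
theorem forms_le_thetaSpaceOf (S : KTypeSituation P ιinf Δ κ₁ τ₁)
    (𝓕 : Set C(relNormOneIdeles K L ⧸ relNormOneRat K L, ℂ)) : S.forms 𝓕 ≤ thetaSpaceOf P ιinf Δ κ₁ τ₁ 𝓕 :=
  le_iSup (fun S : KTypeSituation P ιinf Δ κ₁ τ₁ => S.forms 𝓕) S

/-- (Ported verbatim from the HodgeCMPerL package; no docstring in the source.) -/
theorem restrictHom_mem_thetaSpaceOf (S : KTypeSituation P ιinf Δ κ₁ τ₁)
    {𝓕 : Set C(relNormOneIdeles K L ⧸ relNormOneRat K L, ℂ)} {F : weightForms P.ΓU S.κ S.τ}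
    (hF : F ∈ S.thetaForms 𝓕) : restrictHom ιinf S.hΔ S.hη F ∈ thetaSpaceOf P ιinf Δ κ₁ τ₁ 𝓕 :=
  forms_le_thetaSpaceOf S 𝓕 (S.restrictHom_mem_forms hF)

/-- The theta space is the smallest space containing every situation's restricted theta forms. -/
theorem thetaSpaceOf_le_iff {𝓕 : Set C(relNormOneIdeles K L ⧸ relNormOneRat K L, ℂ)}
    {M : Submodule ℂ (weightForms Δ κ₁ τ₁)} :
    thetaSpaceOf P ιinf Δ κ₁ τ₁ 𝓕 ≤ M ↔ ∀ S : KTypeSituation P ιinf Δ κ₁ τ₁, S.forms 𝓕 ≤ M :=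
  iSup_le_iff

/-- A situation of level `Δ` read at a smaller level `Δ' ≤ Δ` (`IsLevelCorrected.mono`). -/
def KTypeSituation.ofLE {Δ' : Subgroup G₁} (S : KTypeSituation P ιinf Δ κ₁ τ₁) (h : Δ' ≤ Δ) :
    KTypeSituation P ιinf Δ' κ₁ τ₁ where
  Kc := S.Kc
  κ := S.κ
  E := S.E
  σ := S.σ
  τ := S.τ
  ι := S.ι
  hι := S.hι
  η₁ := S.η₁
  hΔ := IsLevelCorrected.mono ιinf h S.hΔ
  hη := S.hη
  𝓙 := S.𝓙

/-- **Level monotonicity of the theta space**: for `Δ' ≤ Δ`, every element of the theta space of level `Δ` is,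
as a function on `G₁`, an element of the theta space of level `Δ'` (the same adelic form restricted in the
situation `S.ofLE h`).  This is the hypothesis `hΘ` of the period lane's level-change lemma
(`thetaClasses_map_mem_of_le`) for the classical instance, when `ιinf` is level-independent. -/
theorem exists_mem_thetaSpaceOf_coe_eq_of_le {Δ' : Subgroup G₁} (h : Δ' ≤ Δ)
    (𝓕 : Set C(relNormOneIdeles K L ⧸ relNormOneRat K L, ℂ)) {F : weightForms Δ κ₁ τ₁}
    (hF : F ∈ thetaSpaceOf P ιinf Δ κ₁ τ₁ 𝓕) :
    ∃ F' ∈ thetaSpaceOf P ιinf Δ' κ₁ τ₁ 𝓕, (F' : G₁ → W) = (F : G₁ → W) := by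
  induction hF using Submodule.iSup_induction' with
  | mem S F hF =>
    obtain ⟨F₀, hF₀, rfl⟩ := Submodule.mem_map.mp hF
    exact ⟨restrictHom ιinf (S.ofLE h).hΔ (S.ofLE h).hη F₀,
      restrictHom_mem_thetaSpaceOf (S.ofLE h) (𝓕 := 𝓕) hF₀, rfl⟩
  | zero => exact ⟨0, Submodule.zero_mem _, rfl⟩
  | add F₁ F₂ _ _ h₁ h₂ =>
    obtain ⟨F₁', h₁', e₁⟩ := h₁
    obtain ⟨F₂', h₂', e₂⟩ := h₂
    exact ⟨F₁' + F₂', Submodule.add_mem _ h₁' h₂', by rw [Submodule.coe_add, Submodule.coe_add, e₁, e₂]⟩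

/-! ### § 3. The junction: one situation's theta classes lie in the classical theta classes -/

variable {H : Type*} [AddCommGroup H] [Module ℂ H]

/-- **KERNEL (content of `ClassSupplyDataAt.theta_sub`)**: for a classical class-map datum `D₀` of level `Δ`
(restriction situation `MonoidHom.id G₁`), the theta classes of the adelic theta forms of ONE `K`-type
situation, read through the transported datum, lie in the theta classes of the classical theta space. -/
theorem thetaClasses_situation_subset_thetaSpace (S : KTypeSituation P ιinf Δ κ₁ τ₁)
    (𝓕 : Set C(relNormOneIdeles K L ⧸ relNormOneRat K L, ℂ)) {ΓU₀ : Subgroup G₁} {η₀ : K₁ →* K₁}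
    {hΔ₀ : IsLevelCorrected ΓU₀ κ₁ τ₁ (MonoidHom.id G₁) Δ}
    {hη₀ : IsWeightMatched κ₁ τ₁ (MonoidHom.id G₁) κ₁ τ₁ η₀} (D₀ : ClassMapDatum (MonoidHom.id G₁) hΔ₀ hη₀ H)
    {Θ₀ : Submodule ℂ (weightForms ΓU₀ κ₁ τ₁)}
    (hΘ₀ : ∀ F ∈ S.forms 𝓕, ∃ F₀ ∈ Θ₀, (F₀ : G₁ → W) = (F : G₁ → W)) :
    thetaClasses ιinf (transportDatum (MonoidHom.id G₁) ιinf D₀ S.hΔ S.hη) (S.thetaForms 𝓕) ⊆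
      thetaClasses (MonoidHom.id G₁) D₀ Θ₀ :=
  thetaClasses_transport_subset (MonoidHom.id G₁) ιinf D₀ fun F' hF' => by
    obtain ⟨F₀, hF₀, h⟩ := hΘ₀ _ (S.restrictHom_mem_forms hF')
    exact ⟨F₀, hF₀, h⟩

/-- The same with `Θ₀ :=` the classical theta space itself (`ΓU₀ = Δ`). -/
theorem thetaClasses_situation_subset_thetaSpaceOf (S : KTypeSituation P ιinf Δ κ₁ τ₁)
    (𝓕 : Set C(relNormOneIdeles K L ⧸ relNormOneRat K L, ℂ)) {η₀ : K₁ →* K₁}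
    {hΔ₀ : IsLevelCorrected Δ κ₁ τ₁ (MonoidHom.id G₁) Δ}
    {hη₀ : IsWeightMatched κ₁ τ₁ (MonoidHom.id G₁) κ₁ τ₁ η₀} (D₀ : ClassMapDatum (MonoidHom.id G₁) hΔ₀ hη₀ H) :
    thetaClasses ιinf (transportDatum (MonoidHom.id G₁) ιinf D₀ S.hΔ S.hη) (S.thetaForms 𝓕) ⊆
      thetaClasses (MonoidHom.id G₁) D₀ (thetaSpaceOf P ιinf Δ κ₁ τ₁ 𝓕) :=
  thetaClasses_situation_subset_thetaSpace S 𝓕 D₀ fun F hF => ⟨F, forms_le_thetaSpaceOf S 𝓕 hF, rfl⟩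

/-! ### § 4. Level-indexed class supply data cut from a situation -/

/-- **Class supply data at `φ_N` from a `K`-type situation**: the situation `S`, a level `Γ₀`, a CLASSICAL
class-map datum `D₀` of `Γ₀ \ 𝔹²` into the model universe, the identification of the model's `Θ_k(Γ₀)` with
(a superset of) the theta classes of the classical theta space, and the analytic properties at `φ_N`. -/
def KTypeSituation.classSupplyDataAt (S : KTypeSituation P ιinf Δ κ₁ τ₁) {U : Universe} (T : U.ThetaModel)
    {Lc : CMField} {ι₁ : Lc →+* ℂ} (V : HermSpace3 Lc ι₁) (c : SeesawCtx Lc) (k : Fin 4) (N : ℕ)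
    (𝓕 : Set C(relNormOneIdeles K L ⧸ relNormOneRat K L, ℂ)) (Γ₀ : Level V) {η₀ : K₁ →* K₁}
    {hΔ₀ : IsLevelCorrected Δ κ₁ τ₁ (MonoidHom.id G₁) Δ} {hη₀ : IsWeightMatched κ₁ τ₁ (MonoidHom.id G₁) κ₁ τ₁ η₀}
    (D₀ : ClassMapDatum (MonoidHom.id G₁) hΔ₀ hη₀ (U.CohC (U.pms Lc ι₁ V Γ₀) 1))
    (hT : thetaClasses (MonoidHom.id G₁) D₀ (thetaSpaceOf P ιinf Δ κ₁ τ₁ 𝓕) ⊆ T.Theta V c k Γ₀)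
    (fam : ∃ j ∈ S.𝓙, ∃ ℓ : Module.Dual ℂ W, j.1 (S.ι ℓ) = P.testFunT N)
    (char_mem : ∀ χ : PontryaginDual (relNormOneIdeles K L ⧸ relNormOneRat K L),
      (∀ t : relNormOneInfUnits K L,
        ((χ ((relNormOneInfToIdeles K L t : relNormOneIdeles K L) :
          relNormOneIdeles K L ⧸ relNormOneRat K L) : Circle) : ℂ) * P.w t = 1) → charInv χ ∈ 𝓕)
    (hol : ∀ j ∈ S.𝓙, ∀ f ∈ 𝓕, restrictHom ιinf S.hΔ S.hη
      (P.kernelDatum.thetaForm (probHaarRelNormOneQuot K L) P.kernelDatum_thetaLinear S.κ j.1 j.2 S.ι S.hι f) ∈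
        D₀.Hol) :
    P.ClassSupplyDataAt T V c k N where
  Kc := S.Kc
  κ := S.κ
  E := S.E
  σ := S.σ
  W := W
  τ := S.τ
  ι := S.ι
  hι := S.hι
  G₁ := G₁
  K₁ := K₁
  ιinf := ιinf
  Δ := Δ
  κ₁ := κ₁
  τ₁ := τ₁
  η₁ := S.η₁
  hΔ := S.hΔ
  hη := S.hη
  Γ₀ := Γ₀
  D := transportDatum (MonoidHom.id G₁) ιinf D₀ S.hΔ S.hη
  𝓙 := S.𝓙
  𝓕 := 𝓕
  fam := fam
  char_mem := char_mem
  hol := hol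
  theta_sub := (thetaClasses_situation_subset_thetaSpaceOf S 𝓕 D₀).trans hT

end Situation

end ThetaSpace
end Model
end HodgeCM

end
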